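import Mathlib
import Summits.Ventures.PercRepro2.HCov
import Summits.Ventures.PercRepro2.RootLeafUMixK
import Summits.Ventures.PercRepro2.RootLeafUXbPD
import Summits.Ventures.PercRepro2.RootLeafUPocketGraph
import Summits.Ventures.PercRepro2.RootLeafUPocketShare
import Summits.Ventures.PercRepro2.RootLeafUPocket3Graph
import Summits.Ventures.PercRepro2.RootLeafUPocket3Sep
import Summits.Ventures.PercRepro2.RootLeafUPocket3Tp
import Summits.Ventures.PercRepro2.RootLeafUPocket3TpMass

/-!
# The boundary-`{u, a₂, c}` pocket at `b`: the (K) identity and the `o ∈ K` half of W1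
(blind cell PercRepro2, p4 g18; S3 (G4-u) item (ae), proofs/P4-G18-PDTHRESHOLD.md §2, §6; no definitions)

`P ∋ b` a pocket with terminal set `{u, a₂, c}`, `o, u, a₂, c ∉ P`.  With the twelve factorisations of
RootLeafUPocket3Sep / RootLeafUPocket3TpMass and the three pocket splits (`W₁ = sep ⊔ W₁cu` and the same
with `a₂ ~ b`, resp. `u ~ b ∨ c ~ b`, where on `sep` the two are exclusive), the `b`-covariance of the
`K`-exploration is exactly a BHK slack times the pocket's `b`-shares:

* **`K_identity`**: `D · X_b = ℋ′ · (P(PD, b ↔ c) − P(PD, bK))` — a `ring` identity after the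
  factorisations (the `(K)` identity of the class, paper §2);
* **`T2oK_nonneg_pocket3`**: hence (XB-PD) holds with the credit `ℋ′·P(PD, b ↔ c) ≥ 0`, and
  `XbPD.T2oK_nonneg_of_XbPD` gives `0 ≤ T2oK` — **the `o ∈ K` half of W1 on every boundary-`{u, a₂, c}`
  pocket**, unconditional, every weight vector.
-/

namespace Summit.Ventures.PercRepro2

open UnionCluster CovForm

namespace RootLeafU

namespace Pocket3

variable {V : Type*} {E : Type*}

section Splits

variable {ends : E → Sym2 V} {P : Set V} {u a₂ c b : V} {inn : Config E → Config E}
variable [Fintype E] [DecidableEq E] {R : Type*} [CommRing R] (p : E → R)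

/-- `W₁ = sep ⊔ W₁cu`. -/
lemma split_W1 :
    prob p {ω : Config E | inn ω ∈ {ω' : Config E | ¬ Conn ends ω' u a₂ ∧ ¬ Conn ends ω' c a₂}} =
      prob p {ω : Config E | inn ω ∈ {ω' : Config E | ¬ Conn ends ω' u a₂ ∧ ¬ Conn ends ω' c a₂ ∧ ¬ Conn ends ω' c u}} +
      prob p {ω : Config E | inn ω ∈ {ω' : Config E | (¬ Conn ends ω' u a₂ ∧ ¬ Conn ends ω' c a₂) ∧ Conn ends ω' c u}} := by
  rw [← prob_union_of_disjoint p]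
  · congr 1
    ext ω
    simp only [Set.mem_setOf_eq, Set.mem_union]
    tauto
  · rw [Set.disjoint_left]
    rintro ω ⟨_, _, h⟩ ⟨_, h'⟩
    exact h h'

/-- `W[W₁, a₂ ~ b] = W[sep, a₂ ~ b] + W[W₁cu, a₂ ~ b]`. -/
lemma split_W1_bK :
    prob p {ω : Config E | inn ω ∈ {ω' : Config E | ¬ Conn ends ω' u a₂ ∧ ¬ Conn ends ω' c a₂} ∩ connEvent ends a₂ b} =
      prob p {ω : Config E | inn ω ∈ {ω' : Config E | (¬ Conn ends ω' u a₂ ∧ ¬ Conn ends ω' c a₂ ∧ ¬ Conn ends ω' c u) ∧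
        Conn ends ω' a₂ b}} +
      prob p {ω : Config E | inn ω ∈ {ω' : Config E | (¬ Conn ends ω' u a₂ ∧ ¬ Conn ends ω' c a₂) ∧ Conn ends ω' c u} ∩
        connEvent ends a₂ b} := by
  rw [← prob_union_of_disjoint p]
  · congr 1
    ext ω
    simp only [Set.mem_setOf_eq, Set.mem_union, Set.mem_inter_iff, mem_connEvent]
    tauto
  · rw [Set.disjoint_left]
    rintro ω ⟨⟨_, _, h⟩, _⟩ ⟨⟨_, h'⟩, _⟩
    exact h h'

/-- `W[W₁, u ~ b ∨ c ~ b] = W[sep, u ~ b] + W[sep, c ~ b] + W[W₁cu, u ~ b ∨ c ~ b]` (on `sep` the two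
are exclusive). -/
lemma split_W1_bL :
    prob p {ω : Config E | inn ω ∈ {ω' : Config E | ¬ Conn ends ω' u a₂ ∧ ¬ Conn ends ω' c a₂} ∩
        (connEvent ends u b ∪ connEvent ends c b)} =
      prob p {ω : Config E | inn ω ∈ {ω' : Config E | (¬ Conn ends ω' u a₂ ∧ ¬ Conn ends ω' c a₂ ∧ ¬ Conn ends ω' c u) ∧
        Conn ends ω' u b}} +
      prob p {ω : Config E | inn ω ∈ {ω' : Config E | (¬ Conn ends ω' u a₂ ∧ ¬ Conn ends ω' c a₂ ∧ ¬ Conn ends ω' c u) ∧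
        Conn ends ω' c b}} +
      prob p {ω : Config E | inn ω ∈ {ω' : Config E | (¬ Conn ends ω' u a₂ ∧ ¬ Conn ends ω' c a₂) ∧ Conn ends ω' c u} ∩
        (connEvent ends u b ∪ connEvent ends c b)} := by
  rw [← prob_union_of_disjoint p, ← prob_union_of_disjoint p]
  · congr 1
    ext ω
    simp only [Set.mem_setOf_eq, Set.mem_union, Set.mem_inter_iff, mem_connEvent]
    tauto
  · rw [Set.disjoint_left]
    rintro ω (⟨⟨_, _, h⟩, _⟩ | ⟨⟨_, _, h⟩, _⟩) ⟨⟨_, h'⟩, _⟩ <;> exact h h'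
  · rw [Set.disjoint_left]
    rintro ω ⟨⟨_, _, h⟩, hub⟩ ⟨⟨_, _, _⟩, hcb⟩
    exact h (conn_trans hcb (conn_symm hub))

end Splits

section Identity

variable {ends : E → Sym2 V} {P : Set V} {o u a₂ c b : V} {off inn : Config E → Config E}
variable [Fintype E] [DecidableEq E] {R : Type*} [CommRing R] (p : E → R)

/-- **The (K) identity of the pocket class**: `D · X_b = ℋ′ · (P(PD, b ↔ c) − P(PD, bK))`
(`X_b`, `ℋ′` as in `MixK.P0_mul_T2oK_eq`, with `P₀ = D + t′`, `P_o = P(PD,oK) + P(T′,oK)`). -/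
theorem K_identity (hP : ∀ e y z, ends e = s(y, z) → y ∈ P → z ∈ P ∨ z = u ∨ z = a₂ ∨ z = c)
    (hoff : (∀ ω e, e ∈ touches ends P → off ω e = false) ∧ (∀ ω e, e ∉ touches ends P → off ω e = ω e))
    (hinn : (∀ ω e, e ∈ touches ends P → inn ω e = ω e) ∧ (∀ ω e, e ∉ touches ends P → inn ω e = false))
    (ho : o ∉ P) (hu : u ∉ P) (ha : a₂ ∉ P) (hc : c ∉ P) (hb : b ∈ P) :
    prob p (PDEvent ends u a₂ c) *
      (prob p (TEvent ends a₂ u c ∩ (connEvent ends a₂ o ∩ connEvent ends a₂ b)) * (prob p (PDEvent ends u a₂ c) + prob p (TEvent ends a₂ u c)) - prob p (TEvent ends a₂ u c ∩ connEvent ends a₂ b) * (prob p (PDEvent ends u a₂ c ∩ connEvent ends a₂ o) + prob p (TEvent ends a₂ u c ∩ connEvent ends a₂ o)) - (prob p (PDEvent ends u a₂ c ∩ (connEvent ends a₂ o ∩ connEvent ends u b)) + prob p (TEvent ends a₂ u c ∩ (connEvent ends a₂ o ∩ connEvent ends u b))) * (prob p (PDEvent ends u a₂ c) + prob p (TEvent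 ends a₂ u c)) + (prob p (PDEvent ends u a₂ c ∩ connEvent ends u b) + prob p (TEvent ends a₂ u c ∩ connEvent ends u b)) * (prob p (PDEvent ends u a₂ c ∩ connEvent ends a₂ o) + prob p (TEvent ends a₂ u c ∩ connEvent ends a₂ o))) =
    (prob p (TEvent ends a₂ u c) * prob p (PDEvent ends u a₂ c ∩ connEvent ends a₂ o) - prob p (PDEvent ends u a₂ c) * prob p (TEvent ends a₂ u c ∩ connEvent ends a₂ o)) *
      (prob p (PDEvent ends u a₂ c ∩ connEvent ends c b) - prob p (PDEvent ends u a₂ c ∩ connEvent ends a₂ b)) := by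
  rw [prob_PD_eq p hP hoff hinn hu ha hc, prob_PD_bK_eq p hP hoff hinn hu ha hc hb,
    prob_PD_bc_eq p hP hoff hinn hu ha hc hb, prob_PD_oK_eq p hP hoff hinn hu ha hc ho,
    prob_PD_bL_eq p hP hoff hinn hu ha hc hb, prob_PD_bL_oK_eq p hP hoff hinn hu ha hc hb ho,
    prob_Tp_eq p hP hoff hinn hu ha hc, prob_Tp_oK_eq p hP hoff hinn hu ha hc ho,
    prob_Tp_bK_eq p hP hoff hinn hu ha hc hb, prob_Tp_bL_eq p hP hoff hinn hu ha hc hb,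
    prob_Tp_oK_bK_eq p hP hoff hinn hu ha hc hb ho, prob_Tp_oK_bL_eq p hP hoff hinn hu ha hc hb ho,
    split_W1 p, split_W1_bK p, split_W1_bL p]
  ring

end Identity

section Theorem

variable {ends : E → Sym2 V} {P : Set V} {o u a₂ c b : V} {off inn : Config E → Config E}
variable [Fintype E] [DecidableEq E] [Fintype V] [DecidableEq V]
  {R : Type*} [Field R] [LinearOrder R] [IsStrictOrderedRing R] (p : E → R)

/-- **The `o ∈ K` half of W1 on every boundary-`{u, a₂, c}` pocket**: `0 ≤ T2oK`. -/
theorem T2oK_nonneg_pocket3 (hp : IsProbVec p)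
    (hP : ∀ e y z, ends e = s(y, z) → y ∈ P → z ∈ P ∨ z = u ∨ z = a₂ ∨ z = c)
    (hoff : (∀ ω e, e ∈ touches ends P → off ω e = false) ∧ (∀ ω e, e ∉ touches ends P → off ω e = ω e))
    (hinn : (∀ ω e, e ∈ touches ends P → inn ω e = ω e) ∧ (∀ ω e, e ∉ touches ends P → inn ω e = false))
    (ho : o ∉ P) (hu : u ∉ P) (ha : a₂ ∉ P) (hc : c ∉ P) (hb : b ∈ P) :
    0 ≤ T2oK p ends o a₂ c b u := by
  apply XbPD.T2oK_nonneg_of_XbPD p ends o a₂ c b u hp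
  rw [K_identity p hP hoff hinn ho hu ha hc hb]
  have hH := MixK.HoK_nonneg p ends o a₂ c u hp
  have hbc := prob_nonneg hp (PDEvent ends u a₂ c ∩ connEvent ends c b)
  nlinarith [mul_nonneg hH hbc]

end Theorem

end Pocket3

end RootLeafU

end Summit.Ventures.PercRepro2
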